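import Mathlib.Algebra.QuadraticAlgebra.NormDeterminant
import Mathlib.NumberTheory.NumberField.ClassNumber
import Literature.NumberTheory.QuadraticFields.ClassNumberOne
import Literature.NumberTheory.QuadraticFields.RealQuadraticUnits
import Literature.NumberTheory.NumberFields.EvenValuationSquare
import HarnessLib

/-!
# The real quadratic field `ℚ(√41)`: integers, class number one, units

Arithmetic of `K = ℚ(√41)`, realised as Mathlib's quadratic algebra `QuadraticAlgebra ℚ 41 0`
(`ω² = 41`), as needed for the complete `2`-descent of `E = 480a1` over `ℚ(√41)` in the rank
computation `rk E(F₄) = 6` of T. Dokchitser–V. Dokchitser, *A note on the Mordell–Weil rank modulo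
n*, J. Number Theory 131 (2011), proof of Thm. 2 ("2-descent … over all minimal non-trivial
subfields of `F₄ = ℚ(√-1, √41, √73)`"). Everything is PROVED (theorems, plus the explicit
elements as definitions; no named facts):

* `K`, `θ = √41`, `φ = (1 + √41)/2` with `φ² = φ + 10`, `IsIntegral ℤ φ`; `finrank ℚ K = 2`,
  `0 < d_K` and `|d_K| ≤ 41` (from the tree's discriminant comparison lemmas, without computing
  `𝓞 K`), so `K` has two real places, unit rank `1` and torsion `{±1}` (tree,
  `RealQuadraticUnits.lean`);
* `norm_eq : Algebra.norm ℚ z = z.re² - 41 z.im²`;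
* **class number one** (`instIsPrincipalIdealRing : IsPrincipalIdealRing (𝓞 K)`): the Minkowski
  bound is `√d_K/2 < 4`; `3` is inert (`X² - X - 10` has no root mod `3`, the tree's
  `isPrincipal_of_mem_primesOver_of_no_root`) and `2 = (3 + φ)(4 - φ)` splits into principal
  primes of norm `2`; Marcus, *Number Fields*, Ch. 5 (the method), and the classical tables
  (`h(ℚ(√41)) = 1`);
* the unit `ε = 27 + 10φ = 32 + 5√41` of norm `-1` (`unitEps`), the two real embeddings `σ s`
  (`√41 ↦ s √41`, `s = ±1`) with `σ 1 ε > 0`, `σ (-1) ε < 0`, and **every totally positive unit is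
  a square** (`exists_sq_eq_of_pos_of_pos`): by Dirichlet (rank `1`, torsion `±1`) every unit is
  `±η^n`, and the sign pattern of `ε` forces `η` to have mixed signs.

## References

* T. Dokchitser, V. Dokchitser, *A note on the Mordell–Weil rank modulo n*, J. Number Theory 131
  (2011) 1833–1839, proof of Thm. 2. [DokchitserDokchitser2011RankModN]
* D. A. Marcus, *Number Fields*, 2nd ed. (2018), Ch. 5, Thm. 37, Cor. 2 and the discussion
  following it (Minkowski bound, class number computations); Ch. 2 (quadratic fields). [folklore]
-/

noncomputable section

open scoped Classical

open Module NumberField NumberField.InfinitePlace NumberField.Units QuadraticAlgebra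

namespace Literature.NumberTheory.QuadraticFields.Sqrt41

open Literature.NumberTheory.QuadraticFields.Quadratic

/-! ### The field -/

/-- `K = ℚ(√41)` as the quadratic algebra `ℚ[ω]/(ω² - 41)`. [folklore] -/
abbrev K : Type := QuadraticAlgebra ℚ 41 0

/-- `41` is not a square in `ℚ`: `v₄₁(r²)` is even, `v₄₁(41) = 1`. [folklore] -/
theorem sq_ne (r : ℚ) : r ^ 2 ≠ (41 : ℚ) + 0 * r := by
  rw [zero_mul, add_zero]
  intro h
  have hr : r ≠ 0 := by rintro rfl; norm_num at h
  haveI : Fact (Nat.Prime 41) := ⟨by norm_num⟩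
  have h1 := congrArg (padicValRat 41) h
  rw [padicValRat.pow, show (41 : ℚ) = ((41 : ℕ) : ℚ) by norm_num,
    padicValRat.self (by norm_num)] at h1
  omega

/-- `K` is a field. [folklore] -/
instance instFact : Fact (∀ r : ℚ, r ^ 2 ≠ (41 : ℚ) + 0 * r) := ⟨sq_ne⟩

/-- `K` is a number field. [folklore] -/
instance instNumberField : NumberField K := NumberField.mk

/-- `[K : ℚ] = 2`. [folklore] -/
theorem finrank_eq_two : finrank ℚ K = 2 := by
  rw [finrank_eq_card_basis (QuadraticAlgebra.basis (41 : ℚ) 0), Fintype.card_fin]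

/-- `θ = √41`. [folklore] -/
def θ : K := ⟨0, 1⟩

/-- `φ = (1 + √41)/2`. [folklore] -/
def φ : K := ⟨1 / 2, 1 / 2⟩

/-- `re θ = 0`. [folklore] -/
@[simp] theorem θ_re : θ.re = 0 := rfl
/-- `im θ = 1`. [folklore] -/
@[simp] theorem θ_im : θ.im = 1 := rfl
/-- `re φ = 1/2`. [folklore] -/
@[simp] theorem φ_re : φ.re = 1 / 2 := rfl
/-- `im φ = 1/2`. [folklore] -/
@[simp] theorem φ_im : φ.im = 1 / 2 := rfl

/-- `θ² = 41`. [folklore] -/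
theorem θ_sq : θ ^ 2 = algebraMap ℚ K 41 := by
  ext <;> simp [θ, sq]

/-- `θ * θ = 41`. [folklore] -/
theorem θ_mul_θ : θ * θ = 41 := by
  ext <;> simp [θ]

/-- `φ² = φ + 10`. [folklore] -/
theorem φ_sq : φ ^ 2 = φ + 10 := by
  ext <;> simp [φ, sq] <;> norm_num

/-- `2φ = 1 + θ`. [folklore] -/
theorem two_mul_φ : 2 * φ = 1 + θ := by
  ext <;> simp [φ, θ]

/-- `θ ∉ ℚ`. [folklore] -/
theorem θ_not_mem_range : θ ∉ Set.range (algebraMap ℚ K) := by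
  rintro ⟨q, hq⟩
  have := congrArg QuadraticAlgebra.im hq
  simp [θ] at this

/-- `φ ∉ ℚ`. [folklore] -/
theorem φ_not_mem_range : φ ∉ Set.range (algebraMap ℚ K) := by
  rintro ⟨q, hq⟩
  have := congrArg QuadraticAlgebra.im hq
  simp [φ] at this

/-- `φ² + (-1)φ + (-10) = 0` with integer coefficients. [folklore] -/
theorem φ_rel : φ ^ 2 + ((-1 : ℤ) : K) * φ + ((-10 : ℤ) : K) = 0 := by
  rw [φ_sq]; push_cast; ring

/-- `φ` is an algebraic integer (root of the monic `X² - X - 10`). [folklore] -/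
theorem isIntegral_φ : IsIntegral ℤ φ := by
  refine ⟨Polynomial.X ^ 2 + Polynomial.C (-1) * Polynomial.X + Polynomial.C (-10), ?_, ?_⟩
  · rw [add_assoc]
    refine (Polynomial.monic_X_pow 2).add_of_left (lt_of_le_of_lt Polynomial.degree_linear_le ?_)
    rw [Polynomial.degree_X_pow]
    norm_num
  · rw [Polynomial.eval₂_add, Polynomial.eval₂_add, Polynomial.eval₂_pow, Polynomial.eval₂_mul,
      Polynomial.eval₂_C, Polynomial.eval₂_X, Polynomial.eval₂_C, eq_intCast, eq_intCast]
    exact φ_rel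

/-- `φ` as an element of `𝓞 K`. [folklore] -/
def φint : 𝓞 K := IsIntegralClosure.mk' (𝓞 K) φ isIntegral_φ

/-- `(φint : K) = φ`. [folklore] -/
@[simp] theorem coe_φint : ((φint : 𝓞 K) : K) = φ :=
  IsIntegralClosure.algebraMap_mk' (𝓞 K) φ isIntegral_φ

/-- The relation in `𝓞 K`: `φ² + (-1)φ + (-10) = 0`. [folklore] -/
theorem φint_rel : (φint : 𝓞 K) ^ 2 + ((-1 : ℤ) : 𝓞 K) * φint + ((-10 : ℤ) : 𝓞 K) = 0 := by
  apply IsFractionRing.injective (𝓞 K) K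
  rw [map_add, map_add, map_pow, map_mul, map_intCast, map_intCast, map_zero]
  show (φint : K) ^ 2 + ((-1 : ℤ) : K) * (φint : K) + ((-10 : ℤ) : K) = 0
  rw [coe_φint]
  exact φ_rel

/-- `φ² = φ + 10` in `𝓞 K`. [folklore] -/
theorem φint_sq : (φint : 𝓞 K) ^ 2 = φint + 10 := by
  have h := φint_rel
  push_cast at h
  linear_combination h

/-! ### Discriminant, real places, unit rank -/

/-- `|d_K| ≤ 41` (from `disc(1, φ) = 41` and `|d_K| ≤ |disc(1, φ)|`). [folklore] -/
theorem abs_discr_le : |(NumberField.discr K : ℚ)| ≤ 41 := by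
  have hrel : φ ^ 2 + algebraMap ℚ K (-1) * φ + algebraMap ℚ K (-10) = 0 := by
    rw [φ_sq]; simp
  refine (abs_discr_le_abs_discr_basisOneSqrt finrank_eq_two φ_not_mem_range isIntegral_φ).trans
    (le_of_eq ?_)
  rw [discr_basisOneSqrt_of_quadratic finrank_eq_two φ_not_mem_range hrel]
  norm_num

/-- `0 < d_K` (`d_K = 41 q²` for a non-zero rational `q`). [folklore] -/
theorem discr_pos : 0 < NumberField.discr K := by
  obtain ⟨q, hq, h⟩ := NumberField.exists_discr_eq_mul_sq finrank_eq_two θ_not_mem_range θ_sq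
  have : (0 : ℚ) < NumberField.discr K := by rw [h]; positivity
  exact_mod_cast this

/-- `K` has two real places and no complex place. [folklore] -/
theorem places : nrRealPlaces K = 2 ∧ nrComplexPlaces K = 0 :=
  nrRealPlaces_eq_two_and_nrComplexPlaces_eq_zero finrank_eq_two discr_pos

/-- The unit rank of `K` is `1`. [folklore] -/
theorem rank_eq_one : rank K = 1 := rank_eq_one_of_discr_pos finrank_eq_two discr_pos

/-! ### Norms -/

/-- The field norm of `K/ℚ` is the quadratic-algebra norm. [folklore] -/
theorem algNorm_eq_norm (z : K) : Algebra.norm ℚ z = z.norm := by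
  rw [Algebra.norm_apply, ← det_toLinearMap_eq_norm]
  congr 1

/-- The field norm of `K/ℚ` is `re² - 41 im²`. [folklore] -/
theorem norm_eq (z : K) : Algebra.norm ℚ z = z.re ^ 2 - 41 * z.im ^ 2 := by
  rw [algNorm_eq_norm, norm_def]; ring

/-- The norm of an algebraic integer, computed in `K`. [folklore] -/
theorem norm_int_eq (x : 𝓞 K) :
    (Algebra.norm ℤ x : ℚ) = (x : K).re ^ 2 - 41 * (x : K).im ^ 2 := by
  rw [Algebra.coe_norm_int, norm_eq]

/-- The absolute norm of a principal ideal `(x)`, computed in `K`: if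
`re(x)² - 41 im(x)² = ± n` then `N((x)) = n`. [folklore] -/
theorem absNorm_span_eq {x : 𝓞 K} {n : ℕ} (h : ((x : K).re ^ 2 - 41 * (x : K).im ^ 2) ^ 2 = (n : ℚ) ^ 2) :
    Ideal.absNorm (Ideal.span {x}) = n := by
  rw [Ideal.absNorm_span_singleton]
  have h1 : ((Algebra.norm ℤ x : ℤ) : ℚ) ^ 2 = ((n : ℤ) : ℚ) ^ 2 := by
    rw [norm_int_eq]; exact_mod_cast h
  have h2 : (Algebra.norm ℤ x) ^ 2 = (n : ℤ) ^ 2 := by exact_mod_cast h1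
  have h3 := (sq_eq_sq_iff_abs_eq_abs _ _).mp h2
  rw [Int.abs_natCast, Int.abs_eq_natAbs] at h3
  exact_mod_cast h3

/-! ### Class number one -/

/-- The Minkowski bound of `K` is `< 4`: `M_K = √d_K/2 ≤ √41/2`. [folklore] -/
theorem floor_M_le :
    ⌊(4 / Real.pi) ^ nrComplexPlaces K *
        ((finrank ℚ K).factorial / (finrank ℚ K : ℝ) ^ finrank ℚ K *
          Real.sqrt |(NumberField.discr K : ℝ)|)⌋₊ ≤ 3 := by
  rw [places.2, finrank_eq_two, pow_zero, one_mul]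
  have hD : |(NumberField.discr K : ℝ)| ≤ 41 := by
    have := abs_discr_le
    rw [← Int.cast_abs] at this ⊢
    exact_mod_cast this
  have hsqrt : Real.sqrt |(NumberField.discr K : ℝ)| < 8 := by
    rw [Real.sqrt_lt' (by norm_num)]
    linarith
  have hfac : ((2 : ℕ).factorial : ℝ) = 2 := by norm_num [Nat.factorial]
  rw [hfac]
  refine Nat.le_of_lt_succ ((Nat.floor_lt (by positivity)).mpr ?_)
  calc 2 / (2 : ℝ) ^ 2 * Real.sqrt |(NumberField.discr K : ℝ)| < 2 / (2 : ℝ) ^ 2 * 8 := by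
        gcongr
    _ = ((3 : ℕ).succ : ℝ) := by norm_num

/-- A principal ideal of prime norm is maximal. [folklore] -/
theorem span_isMaximal_of_absNorm {x : 𝓞 K} {p : ℕ} (hp : p.Prime)
    (h : Ideal.absNorm (Ideal.span {x}) = p) : (Ideal.span {x}).IsMaximal := by
  have hprime : (Ideal.span {x}).IsPrime :=
    Ideal.isPrime_of_irreducible_absNorm (by rw [h]; exact hp)
  refine hprime.isMaximal ?_
  intro h0
  rw [h0, Ideal.absNorm_bot] at h
  exact hp.ne_zero h.symm

/-- `π₂ = 3 + φ = (7 + √41)/2`, of norm `2`. [folklore] -/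
def π₂ : 𝓞 K := 3 + φint

/-- `π₂' = 4 - φ = (7 - √41)/2`, of norm `2`. [folklore] -/
def π₂' : 𝓞 K := 4 - φint

/-- `2 = π₂ π₂'` in `𝓞 K`. [folklore] -/
theorem π₂_mul_π₂' : π₂ * π₂' = 2 := by
  unfold π₂ π₂'
  linear_combination (-1 : 𝓞 K) * φint_sq

/-- `π₂` in `K`. [folklore] -/
theorem coe_π₂ : ((π₂ : 𝓞 K) : K) = 3 + φ := by
  simp [π₂, map_ofNat]

/-- `π₂'` in `K`. [folklore] -/
theorem coe_π₂' : ((π₂' : 𝓞 K) : K) = 4 - φ := by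
  simp [π₂', map_ofNat]

/-- `N((π₂)) = 2`. [folklore] -/
theorem absNorm_span_π₂ : Ideal.absNorm (Ideal.span {π₂}) = 2 :=
  absNorm_span_eq (by rw [coe_π₂]; simp [φ]; norm_num)

/-- `N((π₂')) = 2`. [folklore] -/
theorem absNorm_span_π₂' : Ideal.absNorm (Ideal.span {π₂'}) = 2 :=
  absNorm_span_eq (by rw [coe_π₂']; simp [φ]; norm_num)

/-- `(π₂)` is maximal. [folklore] -/
theorem span_π₂_isMaximal : (Ideal.span {π₂}).IsMaximal :=
  span_isMaximal_of_absNorm Nat.prime_two absNorm_span_π₂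

/-- `(π₂')` is maximal. [folklore] -/
theorem span_π₂'_isMaximal : (Ideal.span {π₂'}).IsMaximal :=
  span_isMaximal_of_absNorm Nat.prime_two absNorm_span_π₂'

/-- **The primes of `𝓞 K` containing `2` are `(π₂)` and `(π₂')`** (`2 = π₂π₂'` splits).
[folklore] -/
theorem eq_span_of_isPrime_of_two_mem {P : Ideal (𝓞 K)} (hP : P.IsPrime) (h2 : (2 : 𝓞 K) ∈ P) :
    P = Ideal.span {π₂} ∨ P = Ideal.span {π₂'} := by
  rw [← π₂_mul_π₂'] at h2
  rcases hP.mem_or_mem h2 with h | h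
  · left
    exact (span_π₂_isMaximal.eq_of_le hP.ne_top ((Ideal.span_singleton_le_iff_mem P).mpr h)).symm
  · right
    exact (span_π₂'_isMaximal.eq_of_le hP.ne_top ((Ideal.span_singleton_le_iff_mem P).mpr h)).symm

/-- A prime of `𝓞 K` above the rational prime `p` contains `p`. [folklore] -/
theorem natCast_mem_of_mem_primesOver {p : ℕ} {P : Ideal (𝓞 K)}
    (hP : P ∈ (Ideal.span {(p : ℤ)}).primesOver (𝓞 K)) : (p : 𝓞 K) ∈ P := by
  obtain ⟨-, hPover⟩ := hP
  have h1 : ((p : ℕ) : ℤ) ∈ P.under ℤ := by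
    rw [← hPover.over]
    exact Ideal.mem_span_singleton_self _
  rw [Ideal.under_def, Ideal.mem_comap, map_natCast] at h1
  exact h1

/-- The primes of `𝓞 K` above `2` are `(π₂)` and `(π₂')`. [folklore] -/
theorem eq_span_of_mem_primesOver_two {p : ℕ} (hp2 : p = 2) {P : Ideal (𝓞 K)}
    (hP : P ∈ (Ideal.span {(p : ℤ)}).primesOver (𝓞 K)) :
    P = Ideal.span {π₂} ∨ P = Ideal.span {π₂'} := by
  subst hp2
  have h2 := natCast_mem_of_mem_primesOver hP
  rw [Nat.cast_ofNat] at h2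
  exact eq_span_of_isPrime_of_two_mem hP.1 h2

/-- `3` is inert: `X² - X - 10` has no root modulo `3`. [folklore] -/
theorem no_root_mod_three : ∀ a : ZMod 3, a ^ 2 + ((-1 : ℤ) : ZMod 3) * a + ((-10 : ℤ) : ZMod 3) ≠ 0 := by
  decide

/-- **`h(ℚ(√41)) = 1`: `𝓞 K` is a principal ideal ring.** Minkowski: every class contains an
ideal of norm `≤ M_K < 4`, so it suffices that the primes above `2` and `3` are principal; `2`
splits into the principal primes `(π₂)`, `(π₂')` and `3` is inert (Marcus, *Number Fields*,
Ch. 5, discussion after Thm. 37; the classical value `h = 1` for `d = 41`). [folklore] -/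
instance instIsPrincipalIdealRing : IsPrincipalIdealRing (𝓞 K) := by
  refine RingOfIntegers.isPrincipalIdealRing_of_isPrincipal_of_pow_le_of_mem_primesOver_of_mem_Icc
    fun p hp hprime P hP _ => ?_
  have hp3 : p ≤ 3 := (Finset.mem_Icc.mp hp).2.trans floor_M_le
  have hp1 : 1 ≤ p := (Finset.mem_Icc.mp hp).1
  interval_cases p
  · exact absurd hprime (by decide)
  · rcases eq_span_of_mem_primesOver_two rfl hP with h | h
    · exact ⟨⟨π₂, by rw [h, Ideal.submodule_span_eq]⟩⟩
    · exact ⟨⟨π₂', by rw [h, Ideal.submodule_span_eq]⟩⟩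
  · exact isPrincipal_of_mem_primesOver_of_no_root finrank_eq_two φint_rel hprime no_root_mod_three hP

/-! ### The two real embeddings -/

/-- `√41 ∈ ℝ` as a root datum for `QuadraticAlgebra.lift`. [folklore] -/
def rootPos : {u : ℝ // u * u = (41 : ℚ) • (1 : ℝ) + (0 : ℚ) • u} :=
  ⟨Real.sqrt 41, by
    rw [zero_smul, add_zero, Rat.smul_one_eq_cast, Real.mul_self_sqrt (by norm_num)]; norm_num⟩

/-- `-√41 ∈ ℝ` as a root datum for `QuadraticAlgebra.lift`. [folklore] -/
def rootNeg : {u : ℝ // u * u = (41 : ℚ) • (1 : ℝ) + (0 : ℚ) • u} :=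
  ⟨-Real.sqrt 41, by
    rw [zero_smul, add_zero, Rat.smul_one_eq_cast, neg_mul_neg, Real.mul_self_sqrt (by norm_num)]
    norm_num⟩

/-- The real embedding `σ⁺ : √41 ↦ √41`. [folklore] -/
def σpos : K →ₐ[ℚ] ℝ := QuadraticAlgebra.lift rootPos

/-- The real embedding `σ⁻ : √41 ↦ -√41`. [folklore] -/
def σneg : K →ₐ[ℚ] ℝ := QuadraticAlgebra.lift rootNeg

/-- `σ⁺ (x + y√41) = x + y√41`. [folklore] -/
theorem σpos_apply (z : K) : σpos z = z.re + z.im * Real.sqrt 41 := by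
  change z.re • (1 : ℝ) + z.im • Real.sqrt 41 = _
  rw [Rat.smul_one_eq_cast, Rat.smul_def]

/-- `σ⁻ (x + y√41) = x - y√41`. [folklore] -/
theorem σneg_apply (z : K) : σneg z = z.re - z.im * Real.sqrt 41 := by
  change z.re • (1 : ℝ) + z.im • (-Real.sqrt 41) = _
  rw [Rat.smul_one_eq_cast, Rat.smul_def]
  ring

/-- `6 < √41 < 7` and `32 < 5√41`. [folklore] -/
theorem sqrt41_bounds : 6 < Real.sqrt 41 ∧ Real.sqrt 41 < 7 ∧ 32 < 5 * Real.sqrt 41 := by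
  refine ⟨?_, ?_, ?_⟩
  · rw [Real.lt_sqrt (by norm_num)]; norm_num
  · rw [Real.sqrt_lt' (by norm_num)]; norm_num
  · have : (32 / 5 : ℝ) < Real.sqrt 41 := by rw [Real.lt_sqrt (by norm_num)]; norm_num
    linarith

/-! ### The unit `ε = 32 + 5√41` of norm `-1` -/

/-- `ε = 27 + 10φ = 32 + 5√41`, a unit of `𝓞 K` of norm `-1` (inverse `-37 + 10φ = 5√41 - 32`).
[folklore] -/
def unitEps : (𝓞 K)ˣ where
  val := 27 + 10 * φint
  inv := -37 + 10 * φint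
  val_inv := by linear_combination (100 : 𝓞 K) * φint_sq
  inv_val := by linear_combination (100 : 𝓞 K) * φint_sq

/-- `ε` in `K`: `32 + 5√41`. [folklore] -/
theorem coe_unitEps : (((unitEps : (𝓞 K)ˣ) : 𝓞 K) : K) = ⟨32, 5⟩ := by
  show (((27 + 10 * φint : 𝓞 K)) : K) = ⟨32, 5⟩
  simp only [map_add, map_mul, map_ofNat, coe_φint]
  ext <;> simp [φ] <;> norm_num

/-- `σ⁺ ε = 32 + 5√41 > 0`. [folklore] -/
theorem σpos_unitEps_pos : 0 < σpos (((unitEps : (𝓞 K)ˣ) : 𝓞 K) : K) := by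
  rw [coe_unitEps, σpos_apply]
  simp only
  have := sqrt41_bounds.1
  push_cast
  positivity

/-- `σ⁻ ε = 32 - 5√41 < 0`. [folklore] -/
theorem σneg_unitEps_neg : σneg (((unitEps : (𝓞 K)ˣ) : 𝓞 K) : K) < 0 := by
  rw [coe_unitEps, σneg_apply]
  have := sqrt41_bounds.2.2
  push_cast
  linarith

/-! ### Signs of units; totally positive units are squares -/

/-- The sign bit of a real number: `1` iff negative. [folklore] -/
def rsign (x : ℝ) : ZMod 2 := if x < 0 then 1 else 0

/-- `rsign` is additive on products of non-zero reals. [folklore] -/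
theorem rsign_mul {x y : ℝ} (hx : x ≠ 0) (hy : y ≠ 0) : rsign (x * y) = rsign x + rsign y := by
  unfold rsign
  rcases lt_or_gt_of_ne hx with hx' | hx' <;> rcases lt_or_gt_of_ne hy with hy' | hy'
  · rw [if_neg (not_lt.mpr (mul_pos_of_neg_of_neg hx' hy').le), if_pos hx', if_pos hy']; decide
  · rw [if_pos (mul_neg_of_neg_of_pos hx' hy'), if_pos hx', if_neg (not_lt.mpr hy'.le)]; decide
  · rw [if_pos (mul_neg_of_pos_of_neg hx' hy'), if_neg (not_lt.mpr hx'.le), if_pos hy']; decide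
  · rw [if_neg (not_lt.mpr (mul_pos hx' hy').le), if_neg (not_lt.mpr hx'.le),
      if_neg (not_lt.mpr hy'.le)]; decide

/-- `rsign x = 0 ↔ 0 < x` for `x ≠ 0`. [folklore] -/
theorem rsign_eq_zero_iff {x : ℝ} (hx : x ≠ 0) : rsign x = 0 ↔ 0 < x := by
  unfold rsign
  rcases lt_or_gt_of_ne hx with h | h
  · rw [if_pos h]; exact ⟨fun h1 => absurd h1 (by decide), fun h1 => absurd h (not_lt.mpr h1.le)⟩
  · rw [if_neg (not_lt.mpr h.le)]; exact ⟨fun _ => h, fun _ => rfl⟩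

/-- A unit of `𝓞 K` is non-zero under a real embedding. [folklore] -/
theorem embedding_unit_ne_zero (τ : K →ₐ[ℚ] ℝ) (u : (𝓞 K)ˣ) : τ ((u : 𝓞 K) : K) ≠ 0 := by
  rw [map_ne_zero, RingOfIntegers.coe_eq_algebraMap, RingOfIntegers.coe_ne_zero_iff]
  exact u.ne_zero

/-- **The sign character of a real embedding on units**, `(𝓞 K)ˣ → ℤ/2` (as a monoid hom into
`Multiplicative (ℤ/2)`). [folklore] -/
def signUnitsHom (τ : K →ₐ[ℚ] ℝ) : (𝓞 K)ˣ →* Multiplicative (ZMod 2) where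
  toFun u := Multiplicative.ofAdd (rsign (τ ((u : 𝓞 K) : K)))
  map_one' := by
    simp only [Units.val_one, map_one]
    rw [rsign, if_neg (not_lt.mpr zero_le_one)]; rfl
  map_mul' u v := by
    rw [← ofAdd_add, ← rsign_mul (embedding_unit_ne_zero τ u) (embedding_unit_ne_zero τ v),
      ← map_mul, Units.val_mul]
    push_cast
    rfl

/-- The value of the sign character. [folklore] -/
theorem signUnitsHom_apply (τ : K →ₐ[ℚ] ℝ) (u : (𝓞 K)ˣ) :
    signUnitsHom τ u = Multiplicative.ofAdd (rsign (τ ((u : 𝓞 K) : K))) := rfl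

/-- The roots of unity of `K` are `±1` (`K` is real). [folklore] -/
theorem torsion_eq_one_or (ζ : torsion K) : (ζ : (𝓞 K)ˣ) = 1 ∨ (ζ : (𝓞 K)ˣ) = -1 := by
  set σ : K →+* ℝ := (σpos : K →ₐ[ℚ] ℝ).toRingHom with hσ
  obtain ⟨n, hn, hx⟩ := isOfFinOrder_iff_pow_eq_one.mp ((CommGroup.mem_torsion _).mp ζ.2)
  set r : ℝ := σ (((ζ : (𝓞 K)ˣ) : 𝓞 K) : K) with hr
  have hrn : r ^ n = 1 := by
    have := congrArg (fun u : (𝓞 K)ˣ => σ ((u : 𝓞 K) : K)) hx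
    simpa [Units.val_pow_eq_pow_val] using this
  have habs : |r| = 1 := by
    have h := congrArg (fun y : ℝ => |y|) hrn
    simp only [abs_pow, abs_one] at h
    exact (pow_eq_one_iff_of_nonneg (abs_nonneg r) hn.ne').mp h
  have hinj : Function.Injective (fun z : 𝓞 K => σ (z : K)) :=
    σ.injective.comp RingOfIntegers.coe_injective
  rcases (abs_eq zero_le_one).mp habs with h | h
  · left
    apply Units.ext
    apply hinj
    simpa [hr] using h
  · right
    apply Units.ext
    apply hinj
    simpa [hr] using h

/-- In `ℤ/2`: the sign equations of the descent on units. [folklore] -/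
theorem zmod2_sign_key : ∀ k n a b c d : ZMod 2, c + k * a = 0 → c + k * b = 1 →
    d + n * a = 0 → d + n * b = 0 → n = 0 ∧ d = 0 := by
  decide

/-- The sign bits of a power of a unit. [folklore] -/
theorem toAdd_signUnitsHom_zpow (τ : K →ₐ[ℚ] ℝ) (u : (𝓞 K)ˣ) (n : ℤ) :
    Multiplicative.toAdd (signUnitsHom τ (u ^ n)) = (n : ZMod 2) * Multiplicative.toAdd (signUnitsHom τ u) := by
  rw [map_zpow, toAdd_zpow, zsmul_eq_mul]

/-- The sign bits of `±1`: equal at both embeddings. [folklore] -/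
theorem signUnitsHom_torsion (ζ : torsion K) :
    Multiplicative.toAdd (signUnitsHom σpos (ζ : (𝓞 K)ˣ)) =
      Multiplicative.toAdd (signUnitsHom σneg (ζ : (𝓞 K)ˣ)) := by
  rcases torsion_eq_one_or ζ with h | h <;> rw [h]
  · rw [(signUnitsHom σpos).map_one, (signUnitsHom σneg).map_one]
  · simp only [signUnitsHom_apply, toAdd_ofAdd, Units.val_neg, Units.val_one]
    push_cast
    rw [map_neg, map_one, map_neg, map_one]

/-- The sign bit of `-1` at `σ⁺` is `1`. [folklore] -/
theorem signUnitsHom_neg_one :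
    Multiplicative.toAdd (signUnitsHom σpos (-1 : (𝓞 K)ˣ)) = 1 := by
  simp only [signUnitsHom_apply, toAdd_ofAdd, Units.val_neg, Units.val_one]
  push_cast
  rw [map_neg, map_one, rsign, if_pos (by norm_num)]

/-- **Every totally positive unit of `ℚ(√41)` is a square.** By Dirichlet's unit theorem
(`rank K = 1`, torsion `±1`) every unit is `ζ η^n` with `ζ = ±1`; the unit `ε = 32 + 5√41` has
`σ⁺ ε > 0 > σ⁻ ε`, so `η` has mixed signs, and then `σ⁺ u, σ⁻ u > 0` forces `n` even and `ζ = 1`.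
[folklore] -/
theorem exists_sq_eq_of_pos_of_pos (u : (𝓞 K)ˣ) (hpos : 0 < σpos ((u : 𝓞 K) : K))
    (hpos' : 0 < σneg ((u : 𝓞 K) : K)) : ∃ w : (𝓞 K)ˣ, u = w ^ 2 := by
  -- the fundamental unit
  have hr : rank K = 1 := rank_eq_one
  set i₀ : Fin (rank K) := ⟨0, by rw [hr]; exact zero_lt_one⟩ with hi₀
  haveI : Subsingleton (Fin (rank K)) := by rw [hr]; infer_instance
  set η : (𝓞 K)ˣ := fundSystem K i₀ with hη
  have hprod : ∀ e : Fin (rank K) → ℤ, ∏ i, fundSystem K i ^ e i = η ^ e i₀ := fun e =>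
    Fintype.prod_subsingleton _ i₀
  -- decompositions of `ε` and `u`
  obtain ⟨⟨ζ₁, e₁⟩, hε, -⟩ := exist_unique_eq_mul_prod K unitEps
  obtain ⟨⟨ζ₂, e₂⟩, hu, -⟩ := exist_unique_eq_mul_prod K u
  simp only at hε hu
  rw [hprod] at hε hu
  -- sign bits
  set a := Multiplicative.toAdd (signUnitsHom σpos η) with ha
  set b := Multiplicative.toAdd (signUnitsHom σneg η) with hb
  set c := Multiplicative.toAdd (signUnitsHom σpos (ζ₁ : (𝓞 K)ˣ)) with hc
  set d := Multiplicative.toAdd (signUnitsHom σpos (ζ₂ : (𝓞 K)ˣ)) with hd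
  have hc' : Multiplicative.toAdd (signUnitsHom σneg (ζ₁ : (𝓞 K)ˣ)) = c :=
    (signUnitsHom_torsion ζ₁).symm
  have hd' : Multiplicative.toAdd (signUnitsHom σneg (ζ₂ : (𝓞 K)ˣ)) = d :=
    (signUnitsHom_torsion ζ₂).symm
  have eq1 : c + (e₁ i₀ : ZMod 2) * a = 0 := by
    have h := congrArg (fun x => Multiplicative.toAdd (signUnitsHom σpos x)) hε
    simp only [map_mul, toAdd_mul, toAdd_signUnitsHom_zpow] at h
    rw [← h, signUnitsHom_apply, toAdd_ofAdd, rsign_eq_zero_iff (embedding_unit_ne_zero _ _)]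
    exact σpos_unitEps_pos
  have eq2 : c + (e₁ i₀ : ZMod 2) * b = 1 := by
    have h := congrArg (fun x => Multiplicative.toAdd (signUnitsHom σneg x)) hε
    simp only [map_mul, toAdd_mul, toAdd_signUnitsHom_zpow, hc'] at h
    rw [← h, signUnitsHom_apply, toAdd_ofAdd, rsign, if_pos σneg_unitEps_neg]
  have eq3 : d + (e₂ i₀ : ZMod 2) * a = 0 := by
    have h := congrArg (fun x => Multiplicative.toAdd (signUnitsHom σpos x)) hu
    simp only [map_mul, toAdd_mul, toAdd_signUnitsHom_zpow] at h
    rw [← h, signUnitsHom_apply, toAdd_ofAdd, rsign_eq_zero_iff (embedding_unit_ne_zero _ _)]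
    exact hpos
  have eq4 : d + (e₂ i₀ : ZMod 2) * b = 0 := by
    have h := congrArg (fun x => Multiplicative.toAdd (signUnitsHom σneg x)) hu
    simp only [map_mul, toAdd_mul, toAdd_signUnitsHom_zpow, hd'] at h
    rw [← h, signUnitsHom_apply, toAdd_ofAdd, rsign_eq_zero_iff (embedding_unit_ne_zero _ _)]
    exact hpos'
  obtain ⟨hn, hd0⟩ := zmod2_sign_key _ _ _ _ _ _ eq1 eq2 eq3 eq4
  -- `n` is even and `ζ₂ = 1`
  obtain ⟨m, hm⟩ : (2 : ℤ) ∣ e₂ i₀ := (ZMod.intCast_zmod_eq_zero_iff_dvd _ 2).mp hn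
  have hζ₂ : (ζ₂ : (𝓞 K)ˣ) = 1 := by
    rcases torsion_eq_one_or ζ₂ with h | h
    · exact h
    · exfalso
      rw [hd, h, signUnitsHom_neg_one] at hd0
      exact one_ne_zero hd0
  refine ⟨η ^ m, ?_⟩
  rw [hu, hζ₂, one_mul, hm, mul_comm, zpow_mul, zpow_ofNat]

/-! ### Even valuations and positivity: squares in `K` -/

/-- **The square theorem for `ℚ(√41)`** (class number one + units): an element `z ∈ Kˣ` with
even valuation at every prime of `𝓞 K` and positive under both real embeddings is a square in
`K`. [folklore] -/
theorem isSquare_of_forall_two_dvd_of_pos {z : K} (hz : z ≠ 0)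
    (hval : ∀ v : IsDedekindDomain.HeightOneSpectrum (𝓞 K), (2 : ℤ) ∣ WithZero.log (v.valuation K z))
    (hpos : 0 < σpos z) (hpos' : 0 < σneg z) : ∃ w : K, z = w ^ 2 := by
  obtain ⟨u, w, hzw⟩ :=
    Literature.NumberTheory.NumberFields.exists_unit_mul_sq_of_forall_two_dvd_log_valuation hz hval
  rw [← RingOfIntegers.coe_eq_algebraMap] at hzw
  have hw : w ≠ 0 := by
    rintro rfl; apply hz; rw [hzw]; ring
  have key : ∀ τ : K →ₐ[ℚ] ℝ, 0 < τ z → 0 < τ ((u : 𝓞 K) : K) := by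
    intro τ hτ
    have h1 : τ z = τ ((u : 𝓞 K) : K) * (τ w) ^ 2 := by rw [hzw, map_mul, map_pow]
    have h2 : 0 < (τ w) ^ 2 := by
      have : τ w ≠ 0 := (map_ne_zero τ).mpr hw
      positivity
    rw [h1] at hτ
    rcases pos_and_pos_or_neg_and_neg_of_mul_pos hτ with ⟨h, -⟩ | ⟨-, h⟩
    · exact h
    · exact absurd h (not_lt.mpr h2.le)
  obtain ⟨t, ht⟩ := exists_sq_eq_of_pos_of_pos u (key σpos hpos) (key σneg hpos')
  refine ⟨((t : 𝓞 K) : K) * w, ?_⟩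
  rw [hzw, ht, Units.val_pow_eq_pow_val]
  push_cast
  ring

end Literature.NumberTheory.QuadraticFields.Sqrt41

end
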